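import Summits.QuantumAdvantage.QuantumAdvantage.Theses.WeilTwice
import Literature.Computability.QuantumComplexity.KedlayaCurveZeta
import Literature.Computability.QuantumComplexity.CWrapAssembly
import Literature.Computability.Cryptography.QubitRegisterCliffordTProofs
import HarnessLib

/-!
# Line `birth` — BC3 skeleton for the crux `JacThreeMemBQP` (stmt-QuantumAdvantage-16537)

Route `WeilTwice` (route-QuantumAdvantage-WeilTwice; deciding theorem
`closes (h₁ : JacThreeMemBQP) (h₂ : PriorBand) (h₃ : BeyondMajority) : QuantumAdvantage`), crux #3 (rank 3):

  `JacThreeMemBQP := L3 ∈ BQP`, where `L3 = enc '' {⟨p, h, u⟩ valid ∧ 3 ∣ #J(y² = h(x)(x − u))(𝔽_p)}`,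

`#J` being the ELEMENTARY Mumford count `jac p g cs u` (pairs `(a, b)`, `a` monic, `deg b < deg a ≤ g`,
`a ∣ b² − h(x)(x−u)`), `g = ⌊√(size p)⌋ / 3`, `h = X^{2g} + Σ csᵢ Xⁱ`, and `enc` the route's fixed-width code
`⟨bin p, ⟨blocks of cs on size p bits each, u on size p bits⟩⟩` (tree model `Literature.Computability.Cryptography.BQP`:
ONE `P`-uniform oracle-free Clifford+T family, error `≤ 1/3`).

## The line (the route's own two-layer plan: Kedlaya ∘ FP pre-processing ∘ FP post-processing)

* `stub_kedlaya` (QUANTUM, size XL — the load-bearing stub): the tree's named fact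
  `Literature.Computability.QuantumComplexity.kedlaya2006_hyperellipticJacobianOrder_isQSolvable`
  (Kedlaya, Comput. Complexity 15 (2006) = arXiv:math/0411623, Thm 1 with Prop 4; vendored p123892, commit
  04ab6e4): on input `encodeHyperellipticInstance p cs'` (list code) with `IsOddHyperellipticInstance p cs'`
  (`p` odd prime, reduced coefficients, odd degree, `monicOfCoeffs p cs'` squarefree) ONE uniform Clifford+T
  family writes the SELF-DELIMITED prefix `boolPair (encodeNat #J) []`, `#J = mumfordCount p (|cs'|/2) F`, with
  probability `≥ 2/3`.  To DISCHARGE it (the crux cannot close before): Cantor's group law on reduced Mumford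
  pairs compiled reversibly (white-box abelian group with unique labels), near-uniform random classes from
  random effective divisors of degree `≥ 2g − 1` (Kedlaya Lemma 7 + Lemma 10, `16g < √p`, else base-change),
  and the abelian-group ORDER algorithm (Watrous 2001 / Cheung–Mosca 2001: Shor orders + HSP over
  `ℤ_{r₁} × … × ℤ_{r_k}`) — in the tree this is the shared crux `DarkClassGroups.AbelianGroupOrderFBQP`
  (stmt-QuantumAdvantage-3193) specialised to the Cantor family, plus coins.  Why it might fail: only AS TYPED
  (one uniform family with `k = O(g log p)` growing period-finding registers, Las Vegas sampling inside the
  `2/3`); mathematically a published, unconditional theorem (Weil's bound boxes `#J`).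
* `stub_expand` (CLASSICAL PRE-PROCESSING in `FP`, size M): ONE polynomial-time string function `T` mapping the
  route's fixed-width code of `⟨p, cs, u⟩` (any `p ≥ 2`, entries `< p`, `u < p`) to Kedlaya's input
  `encodeHyperellipticInstance p cs'`, where `cs'` is the list of the `|cs| + 1` REDUCED low coefficients of
  `h(x)(x − u) = monicOfCoeffs p cs * (X − u)` (so `monicOfCoeffs p cs' = h(x)(x−u)`): parse `boolPair`/fixed-width
  blocks (width `size p` read off `bin p`), one polynomial multiplication by a linear factor mod `p`
  (`c'ᵢ = c_{i−1} − u cᵢ mod p`), re-encode with `encodingListNatBool`.  Why it might fail: not mathematically;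
  `FP` bookkeeping (block parsing + `encodingListNatBool` writer) is routine but new.
* `stub_decode` (CLASSICAL VALIDATION + READ-OUT in `FP`, size L): ONE polynomial-time `D` with
  (a) `D ⟨x, w⟩ = [false]` whenever `x` is NOT the code of a valid instance (valid = `p` prime (AKS:
  `PRIMES_mem_P_holds` / `primeFn_mem_FP` in tree), `5 ≤ p`, `|cs| = 2(⌊√(size p)⌋/3)`, entries `< p`, `u < p`,
  `h(x)(x−u)` squarefree (`gcd(F, F′) = 1` over `𝔽_p`, Euclid in `𝔽_p[x]` — new to the tree)); and
  (b) `D ⟨enc⟨p, cs, u⟩, ⟨bin N, z⟩⟩ = [decide (3 ∣ N)]` on valid instances (read the self-delimited count, reduce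
  mod 3).  Why it might fail: not mathematically; the squarefreeness test in `FP` is the only new brick.
* Composition `JacThreeMemBQP_of` (sorry-free, kernel-checked): Bernstein–Vazirani §8 "P-computation is free
  inside BQP" — wrap Kedlaya's family with `T` before and `D` after (`isQSolvable_classicalWrap_holds`), check
  that on EVERY input the wrapped family writes the indicator bit of `L3` first (on valid codes by (b) + the
  fact's prefix, using that two self-delimited prefixes of one string carry the same number, so no injectivity
  of `enc` is needed; off valid codes by (a), where membership is false), and read wire `0`
  (`mem_BQP_of_isQSolvable_bit` with `QCircuit.outputPMF_apply_holds`, `cliffordT_isUnitary_holds`).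

Disproof used: none exists for this crux (`ledger crux ls stmt-QuantumAdvantage-16537`: no workfiles, no
`Disproof.lean`, no `Theorems/…/Negative`; `ledger negatives --problem QuantumAdvantage`: 6 entries, none near).
`sorry` occurs ONLY in the three `stub_*` theorems; `JacThreeMemBQP_of` takes the three stub statements (the
`Goal.stub_*` abbreviations, restated verbatim by the stubs) and concludes the crux decl BY NAME; the `example`
at the end checks that the registered stubs feed it.
-/

set_option linter.dupNamespace false
set_option linter.unusedVariables false

noncomputable section

namespace Summit.QuantumAdvantage.QuantumAdvantage.Cruxes.JacThreeMemBQP.Birth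

open _root_.Computability Literature.Computability.Complexity Literature.Computability.Cryptography
open Literature.Computability.QuantumComplexity (monicOfCoeffs mumfordCount IsOddHyperellipticInstance
  encodeHyperellipticInstance kedlaya2006_hyperellipticJacobianOrder_isQSolvable)
open Summit.QuantumAdvantage.QuantumAdvantage.Theses.WeilTwice (JacThreeMemBQP)
open Polynomial

/-! ### The three stub statements (named, so that the composition can take them as hypotheses) -/

namespace Goal

/-- Statement of `stub_kedlaya`: the tree's named fact (Kedlaya 2006 Thm 1 + Prop 4, odd-degree hyperelliptic
prime-field case, self-delimited class-number output). -/
abbrev stub_kedlaya : Prop :=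
  kedlaya2006_hyperellipticJacobianOrder_isQSolvable

/-- Statement of `stub_expand`: the `FP` transducer from the route's fixed-width code of `⟨p, cs, u⟩` to
Kedlaya's list-coded instance `⟨p, cs'⟩` with `monicOfCoeffs p cs' = monicOfCoeffs p cs * (X − u)`,
`|cs'| = |cs| + 1`, entries reduced. -/
abbrev stub_expand : Prop :=
  ∃ T : List Bool → List Bool, T ∈ FP ∧
    ∀ (p : ℕ) (cs : List ℕ) (u : ℕ), 2 ≤ p → (∀ c ∈ cs, c < p) → u < p →
      ∃ cs' : List ℕ, (∀ c ∈ cs', c < p) ∧ cs'.length = cs.length + 1 ∧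
        monicOfCoeffs p cs' = monicOfCoeffs p cs * (X - C ((u : ℕ) : ZMod p)) ∧
        T (boolPair (encodeNat p) (boolPair
            ((cs.map fun c => List.ofFn fun i : Fin p.size => Nat.testBit c i).flatten)
            (List.ofFn fun i : Fin p.size => Nat.testBit u i))) = encodeHyperellipticInstance p cs'

/-- Statement of `stub_decode`: the `FP` validator / mod-3 reader — `[false]` off the valid codes, the bit
`[3 ∣ N]` on `⟨valid code, ⟨bin N, z⟩⟩`. -/
abbrev stub_decode : Prop :=
  ∃ D : List Bool → List Bool, D ∈ FP ∧
    (∀ x w : List Bool,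
      (∀ (p : ℕ) (cs : List ℕ) (u : ℕ), p.Prime → 5 ≤ p → cs.length = 2 * (Nat.sqrt p.size / 3) →
        (∀ c ∈ cs, c < p) → u < p → Squarefree (monicOfCoeffs p cs * (X - C ((u : ℕ) : ZMod p))) →
        x ≠ boolPair (encodeNat p) (boolPair
            ((cs.map fun c => List.ofFn fun i : Fin p.size => Nat.testBit c i).flatten)
            (List.ofFn fun i : Fin p.size => Nat.testBit u i))) →
      D (boolPair x w) = [false]) ∧
    (∀ (p : ℕ) (cs : List ℕ) (u N : ℕ) (z : List Bool), p.Prime → 5 ≤ p →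
      cs.length = 2 * (Nat.sqrt p.size / 3) → (∀ c ∈ cs, c < p) → u < p →
      Squarefree (monicOfCoeffs p cs * (X - C ((u : ℕ) : ZMod p))) →
      D (boolPair (boolPair (encodeNat p) (boolPair
            ((cs.map fun c => List.ofFn fun i : Fin p.size => Nat.testBit c i).flatten)
            (List.ofFn fun i : Fin p.size => Nat.testBit u i))) (boolPair (encodeNat N) z)) =
        [decide (3 ∣ N)])

end Goal

/-! ### The stubs (registered; `sorry` lives only here) -/

/-- **stub_kedlaya** (quantum; Kedlaya2006b = arXiv:math/0411623 Thm 1 + Prop 4, via Cantor1987 arithmetic,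
Lemma 7/10 sampling, Watrous2001 / CheungMosca2001 abelian group order = tree crux
`DarkClassGroups.AbelianGroupOrderFBQP` specialised; XL). -/
theorem stub_kedlaya : kedlaya2006_hyperellipticJacobianOrder_isQSolvable := by
  sorry

/-- **stub_expand** (classical `FP` pre-processing: fixed-width blocks ↦ reduced coefficient list of
`h(x)(x − u)`; M). -/
theorem stub_expand : ∃ T : List Bool → List Bool, T ∈ FP ∧ ∀ (p : ℕ) (cs : List ℕ) (u : ℕ), 2 ≤ p → (∀ c ∈ cs, c < p) → u < p → ∃ cs' : List ℕ, (∀ c ∈ cs', c < p) ∧ cs'.length = cs.length + 1 ∧ monicOfCoeffs p cs' = monicOfCoeffs p cs * (X - C ((u : ℕ) : ZMod p)) ∧ T (boolPair (encodeNat p) (boolPair ((cs.map fun c => List.ofFn fun i : Fin p.size => Nat.testBit c i).flatten) (List.ofFn fun i : Fin p.size => Nat.testBit u i))) = encodeHyperellipticInstance p cs' := by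
  sorry

/-- **stub_decode** (classical `FP` validation — AKS, bounds, `gcd(F, F') = 1` — and the mod-3 read-out of the
self-delimited count; L). -/
theorem stub_decode : ∃ D : List Bool → List Bool, D ∈ FP ∧ (∀ x w : List Bool, (∀ (p : ℕ) (cs : List ℕ) (u : ℕ), p.Prime → 5 ≤ p → cs.length = 2 * (Nat.sqrt p.size / 3) → (∀ c ∈ cs, c < p) → u < p → Squarefree (monicOfCoeffs p cs * (X - C ((u : ℕ) : ZMod p))) → x ≠ boolPair (encodeNat p) (boolPair ((cs.map fun c => List.ofFn fun i : Fin p.size => Nat.testBit c i).flatten) (List.ofFn fun i : Fin p.size => Nat.testBit u i))) → D (boolPair x w) = [false]) ∧ (∀ (p : ℕ) (cs : List ℕ) (u N : ℕ) (z : List Bool), p.Prime → 5 ≤ p → cs.length = 2 * (Nat.sqrt p.size / 3) → (∀ c ∈ cs, c < p) → u < p → Squarefree (monicOfCoeffs p cs * (X - C ((u : ℕ) : ZMod p))) → D (boolPair (boolPair (encodeNat p) (boolPair ((cs.map fun c => List.ofFn fun i : Fin p.size => Nat.testBit c i).flatten) (List.ofFn fun i : Fin p.size => Nat.testBit u i)))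 (boolPair (encodeNat N) z)) = [decide (3 ∣ N)]) := by
  sorry

/-! ### The route's vocabulary, named (definitionally the `let`s of the crux statement) -/

/-- The route's family `F p cs u = h(x)(x − u)`, `h = X^{|cs|} + Σ csᵢ Xⁱ` (= `monicOfCoeffs p cs * (X − u)`). -/
def F (p : ℕ) (cs : List ℕ) (u : ℕ) : Polynomial (ZMod p) :=
  ((Polynomial.X : Polynomial (ZMod p)) ^ cs.length +
      ∑ i ∈ Finset.range cs.length, Polynomial.C ((cs.getD i 0 : ℕ) : ZMod p) * Polynomial.X ^ i) *
    (Polynomial.X - Polynomial.C ((u : ℕ) : ZMod p))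

/-- The route's Mumford count `jac p g cs u` (= `mumfordCount p g (F p cs u)`). -/
def jac (p g : ℕ) (cs : List ℕ) (u : ℕ) : ℕ :=
  Nat.card {w : Polynomial (ZMod p) × Polynomial (ZMod p) //
    w.1.Monic ∧ w.1.natDegree ≤ g ∧ w.2.degree < w.1.degree ∧ w.1 ∣ w.2 ^ 2 - F p cs u}

/-- The route's validity predicate on triples `⟨p, cs, u⟩`. -/
def Valid (x : ℕ × List ℕ × ℕ) : Prop :=
  x.1.Prime ∧ 5 ≤ x.1 ∧ x.2.1.length = 2 * (Nat.sqrt x.1.size / 3) ∧ (∀ c ∈ x.2.1, c < x.1) ∧ x.2.2 < x.1 ∧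
    Squarefree (F x.1 x.2.1 x.2.2)

/-- The route's fixed-width code of a triple. -/
def enc (x : ℕ × List ℕ × ℕ) : List Bool :=
  boolPair (encodeNat x.1) (boolPair
    ((x.2.1.map fun c => List.ofFn fun i : Fin x.1.size => Nat.testBit c i).flatten)
    (List.ofFn fun i : Fin x.1.size => Nat.testBit x.2.2 i))

/-- The witness language `L3`. -/
def L3 : Language Bool :=
  enc '' {x | Valid x ∧ 3 ∣ jac x.1 (Nat.sqrt x.1.size / 3) x.2.1 x.2.2}

/-- The crux, by name, is `L3 ∈ BQP` (pure unfolding of the `let`s). -/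
theorem jacThreeMemBQP_iff : JacThreeMemBQP ↔ L3 ∈ BQP := Iff.rfl

/-- Unfolding of `Valid` on a triple, in the stubs' vocabulary. -/
theorem valid_iff (p : ℕ) (cs : List ℕ) (u : ℕ) :
    Valid (p, cs, u) ↔ p.Prime ∧ 5 ≤ p ∧ cs.length = 2 * (Nat.sqrt p.size / 3) ∧ (∀ c ∈ cs, c < p) ∧
      u < p ∧ Squarefree (monicOfCoeffs p cs * (X - C ((u : ℕ) : ZMod p))) :=
  Iff.rfl

/-- Unfolding of `enc` on a triple, in the stubs' vocabulary. -/
theorem enc_eq (p : ℕ) (cs : List ℕ) (u : ℕ) :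
    enc (p, cs, u) = boolPair (encodeNat p) (boolPair
      ((cs.map fun c => List.ofFn fun i : Fin p.size => Nat.testBit c i).flatten)
      (List.ofFn fun i : Fin p.size => Nat.testBit u i)) :=
  rfl

/-- `jac` is Kedlaya's `mumfordCount` of `monicOfCoeffs p cs * (X − u)`. -/
theorem jac_eq (p g : ℕ) (cs : List ℕ) (u : ℕ) :
    jac p g cs u = mumfordCount p g (monicOfCoeffs p cs * (X - C ((u : ℕ) : ZMod p))) :=
  rfl

/-! ### Two facts about the self-delimiting pairing -/

/-- A string with the self-delimited prefix `⟨a, []⟩` IS a pair `⟨a, z⟩`. -/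
theorem exists_eq_boolPair_of_prefix {a y : List Bool} (h : boolPair a [] <+: y) : ∃ z, y = boolPair a z := by
  obtain ⟨z, rfl⟩ := h
  exact ⟨z, by simp [boolPair, List.append_assoc]⟩

/-- Two self-delimited numeric prefixes of the same string carry the same number. -/
theorem eq_of_prefix_boolPair_encodeNat {N M : ℕ} {z : List Bool}
    (h : boolPair (encodeNat M) [] <+: boolPair (encodeNat N) z) : M = N := by
  obtain ⟨z', hz'⟩ := exists_eq_boolPair_of_prefix h
  have h1 := congrArg boolUnpair hz'
  simp only [boolUnpair_boolPair, Prod.mk.injEq] at h1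
  have h2 := congrArg decodeNat h1.1
  simpa using h2.symm

/-! ### The composition (sorry-free) -/

open scoped Classical in
/-- **`L3 ∈ BQP` from the three stubs** (Bernstein–Vazirani 1997 §8 pattern: `FP` pre-processing `T`, Kedlaya's
family, `FP` post-processing `D`, read wire `0`). -/
theorem L3_mem_BQP (h₁ : Goal.stub_kedlaya) (h₂ : Goal.stub_expand) (h₃ : Goal.stub_decode) : L3 ∈ BQP := by
  obtain ⟨T, hTFP, hT⟩ := h₂
  obtain ⟨D, hDFP, hDoff, hDon⟩ := h₃
  have hW := isQSolvable_classicalWrap_holds T D hTFP hDFP h₁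
  refine mem_BQP_of_isQSolvable_bit (fun _ _ => QCircuit.outputPMF_apply_holds) cliffordT_isUnitary_holds
    (L := L3) (bit := fun x => decide (x ∈ L3)) (fun x => decide_eq_true_iff) ?_
  refine hW.mono fun x w hw => ?_
  obtain ⟨y, hy, hyw⟩ := hw
  suffices hD : D (boolPair x y) = [decide (x ∈ L3)] by
    simpa only [Set.mem_setOf_eq, hD] using hyw
  simp only [Set.mem_setOf_eq] at hy
  by_cases hx : ∃ (p : ℕ) (cs : List ℕ) (u : ℕ), Valid (p, cs, u) ∧ x = enc (p, cs, u)
  · -- on the valid codes: `y` carries the self-delimited count, `D` reads it mod 3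
    obtain ⟨p, cs, u, hv, rfl⟩ := hx
    obtain ⟨hp, h5, hlen, hcs, hu, hsq⟩ := (valid_iff p cs u).1 hv
    obtain ⟨cs', hcs', hlen', hmon, hTx⟩ := hT p cs u (by omega) hcs hu
    have hinst : IsOddHyperellipticInstance p cs' :=
      ⟨hp, by omega, hcs', ⟨Nat.sqrt p.size / 3, by omega⟩, by rw [hmon]; exact hsq⟩
    have hpre := hy p cs' (by rw [enc_eq]; exact hTx) hinst
    have hg : cs'.length / 2 = Nat.sqrt p.size / 3 := by omega
    rw [hg, hmon] at hpre
    obtain ⟨z, rfl⟩ := exists_eq_boolPair_of_prefix hpre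
    rw [enc_eq, hDon p cs u _ z hp h5 hlen hcs hu hsq, ← enc_eq]
    refine congrArg (fun b => [b]) (decide_eq_decide.mpr ?_)
    constructor
    · intro h3
      exact Set.mem_image_of_mem enc (show (p, cs, u) ∈ {x | _} from ⟨hv, by rw [jac_eq]; exact h3⟩)
    · rintro ⟨⟨p', cs'', u'⟩, ⟨hv', h3'⟩, he⟩
      obtain ⟨hp', h5', hlen'', hcs'', hu', hsq'⟩ := (valid_iff p' cs'' u').1 hv'
      obtain ⟨cs₂, hcs₂, hlen₂, hmon₂, hTx₂⟩ := hT p' cs'' u' (by omega) hcs'' hu'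
      have hinst₂ : IsOddHyperellipticInstance p' cs₂ :=
        ⟨hp', by omega, hcs₂, ⟨Nat.sqrt p'.size / 3, by omega⟩, by rw [hmon₂]; exact hsq'⟩
      have hpre₂ := hy p' cs₂ (by rw [← he, enc_eq]; exact hTx₂) hinst₂
      have hg₂ : cs₂.length / 2 = Nat.sqrt p'.size / 3 := by omega
      rw [hg₂, hmon₂] at hpre₂
      have hN := eq_of_prefix_boolPair_encodeNat hpre₂
      rw [← jac_eq] at hN
      rw [← hN]
      exact h3'
  · -- off the valid codes: `D` answers `[false]` and `x ∉ L3`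
    rw [hDoff x y fun p cs u hp h5 hlen hcs hu hsq hxe =>
      hx ⟨p, cs, u, (valid_iff p cs u).2 ⟨hp, h5, hlen, hcs, hu, hsq⟩, by rw [enc_eq]; exact hxe⟩]
    have hxL : x ∉ L3 := by
      rintro ⟨⟨p, cs, u⟩, ⟨hv, -⟩, he⟩
      exact hx ⟨p, cs, u, hv, he.symm⟩
    exact congrArg (fun b => [b]) (decide_eq_false hxL).symm

/-- **Composition of the birth line** (kernel-checked, no `sorry`): the three stub statements give the crux
`Theses.WeilTwice.JacThreeMemBQP` BY NAME. -/
theorem JacThreeMemBQP_of (h₁ : Goal.stub_kedlaya) (h₂ : Goal.stub_expand) (h₃ : Goal.stub_decode) :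
    JacThreeMemBQP :=
  jacThreeMemBQP_iff.2 (L3_mem_BQP h₁ h₂ h₃)

/-- The registered stubs feed the composition (checks that the inline stub statements are the `Goal.*` ones). -/
example : JacThreeMemBQP := JacThreeMemBQP_of stub_kedlaya stub_expand stub_decode

end Summit.QuantumAdvantage.QuantumAdvantage.Cruxes.JacThreeMemBQP.Birth

end
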